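import Summits.Ventures.LatticeQCDFlow.Scoring.SU2TorusPartitionFunction
import Summits.Ventures.YMGap.Census.CubeMerge
import HarnessLib

/-!
# Venture YMGap, track (b) — the EXACTLY SOLVABLE two-dimensional case: Tomboulis's `Z`, `Z⁻` and the
# vortex ratio on the 2-torus `(ℤ/L)²` in closed form, for every `L`, every spin cut-off `J`, every `c`

HONEST FRAMING: venture file of the cell `pub-ymgap` (QuantumFields programme), track (b).  The cell's STEP-0
demanded "the exactly solvable 2D case"; this file turns that row into kernel theorems in the census
vocabulary (`Tomboulis2007.torusZ`, `torusZtw`, `vortexRatio`, the `Prop`s `TwistLe`, `CoeffMonotone`,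
`VortexRatioAntitone`, `Ineq515`).  It says NOTHING about `d = 4`, limits, confinement or a mass gap: in two
dimensions every statement below is an identity between finite sums.

With `A = L²` plaquettes and the Haar-integral evaluation of the sibling cell `pub-lqcd`
(`LatticeQCDFlow.Scoring.integral_prod_su2Character_plaquettes`:
`∫ ∏_x χ_{m_x}(U_x) dHaar^{⊗E} = [m ≡ m₀]·(m₀+1)^{−L²}` on `(ℤ/L)²`):

* `integral_prod_faceSum_two` — for plaquette-dependent character sums `Σ_{n ≤ J} a_x(n) χ_n(U_x)`:
  `∫ ∏_x (Σ_n a_x(n) χ_n(U_x)) = Σ_{n ≤ J} (∏_x a_x(n)) (n+1)^{−L²}`;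
* **`torusZ_two`** — `Z_{(ℤ/L)²}({c_j}) = 1 + Σ_{n=1}^{J} c_n^{L²}` (Tomboulis's normalised `f = 1 + Σ d_j c_j χ_j`;
  the genus-one character formula `Σ_r (c_r/d_r)^A d_r^{2−2g}`, Drouffe–Zuber 1983 §2.2 / Migdal 1975);
* **`torusZtw_two`** — `Z⁻_V = 1 + Σ_{n=1}^{J} (−1)^{n·|V|} c_n^{L²}` for EVERY plaquette set `V`, and
  `torusZtw_two_vortexSheet` — Tomboulis's `𝒱₀₁` is one plaquette in `d = 2`: `Z⁻ = 1 + Σ_n (−1)^n c_n^{L²}`;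
* the corollaries (IV.1, II.1 (i), (5.23)/(5.24), (5.15) with and without the positivity guard) are in the
  companion file `Census/TwoDimExactRows.lean`.

References: E. T. Tomboulis, arXiv:0707.2179 §§2, 4, 5 [cite: Tomboulis2007Confinement, §2 (2.5)–(2.7), §4 (4.2)–(4.5),
§5 (5.15)–(5.24)]; J.-M. Drouffe, J.-B. Zuber, Phys. Rept. 102 (1983) 1, §2.2 eqs. (2.17)–(2.18) (triviality of
two-dimensional lattice gauge theories) [folklore].
-/

noncomputable section

open MeasureTheory Finset Real Function Polynomial.Chebyshev
open scoped BigOperators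
open Literature.MathematicalPhysics.QuantumLattice
open Literature.MathematicalPhysics.QuantumFieldTheory
open Literature.MathematicalPhysics.QuantumFieldTheory.Tomboulis2007
open Summit.Ventures.LatticeQCDFlow.Exactness
open Summit.Ventures.LatticeQCDFlow.Scoring

namespace Summit.Ventures.YMGap.Census

variable {L : ℕ} [NeZero L]

/-! ### The character expansion on the 2-torus with plaquette-dependent coefficients -/

/-- **Plaquette-dependent character sums integrate in closed form on `(ℤ/L)²`**:
`∫ ∏_x (Σ_{n ≤ J} a_x(n) χ_n(U_x)) dHaar^{⊗E} = Σ_{n ≤ J} (∏_x a_x(n))·((n+1)^{L²})⁻¹` — expand the product,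
integrate each character monomial by `integral_prod_su2Character_plaquettes` (only constant assignments
survive). -/
theorem integral_prod_faceSum_two (J : ℕ) (a : Site 2 L → ℕ → ℝ) :
    ∫ V, ∏ x : Site 2 L, faceSum J (a x) (plaquetteHolonomy V x 0 1)
        ∂(Measure.pi fun _ : Edge 2 L => haarProbability SU2) =
      ∑ n ∈ Finset.range (J + 1), (∏ x : Site 2 L, a x n) * ((((n : ℝ) + 1) ^ (L ^ 2)))⁻¹ := by
  classical
  have hexp : ∀ V : GaugeConfig 2 L SU2,
      ∏ x : Site 2 L, faceSum J (a x) (plaquetteHolonomy V x 0 1) =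
        ∑ m ∈ Fintype.piFinset (fun _ : Site 2 L => Finset.range (J + 1)),
          (∏ x, a x (m x)) * ∏ x, (U ℝ (m x)).eval (su2a0 (plaquetteHolonomy V x 0 1)) := by
    intro V
    unfold faceSum
    rw [Finset.prod_univ_sum]
    refine Finset.sum_congr rfl fun m _ => ?_
    rw [Finset.prod_mul_distrib]
  simp_rw [hexp]
  have hint : ∀ m : Site 2 L → ℕ, Integrable (fun V : GaugeConfig 2 L SU2 =>
      (∏ x, a x (m x)) * ∏ x, (U ℝ (m x)).eval (su2a0 (plaquetteHolonomy V x 0 1)))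
      (Measure.pi fun _ : Edge 2 L => haarProbability SU2) := by
    intro m
    refine integrable_pi_su2_of_continuous (continuous_const.mul ?_)
    refine continuous_finsetProd _ fun x _ => continuous_su2Character_comp (m x) ?_
    unfold plaquetteHolonomy
    fun_prop
  rw [integral_finsetSum _ (fun m _ => hint m)]
  simp_rw [integral_const_mul, integral_prod_su2Character_plaquettes, mul_ite, mul_zero]
  rw [Finset.sum_ite, Finset.sum_const_zero, add_zero]
  have hset : (Fintype.piFinset fun _ : Site 2 L => Finset.range (J + 1)).filter
      (fun m => ∀ x, m x = m 0) = (Finset.range (J + 1)).image (fun n : ℕ => fun _ : Site 2 L => n) := by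
    ext m
    simp only [Finset.mem_filter, Fintype.mem_piFinset, Finset.mem_image]
    constructor
    · rintro ⟨hm, hc⟩
      exact ⟨m 0, hm 0, funext fun x => (hc x).symm⟩
    · rintro ⟨n, hn, rfl⟩
      exact ⟨fun _ => hn, fun _ => rfl⟩
  rw [hset, Finset.sum_image fun n _ n' _ h => congrFun h 0]

/-- `#Λ = L²` for `Λ = (ℤ/L)²`. -/
theorem card_univ_site_two : (Finset.univ : Finset (Site 2 L)).card = L ^ 2 := by
  rw [Finset.card_univ, Fintype.card_pi, Finset.prod_const, ZMod.card, Finset.card_univ, Fintype.card_fin]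

/-- `stdCoef c n ^ {L²} · ((n+1)^{L²})⁻¹` is `1` at `n = 0` and `c_n^{L²}` for `n ≥ 1`. -/
theorem stdCoef_pow_mul_inv (c : ℕ → ℝ) (n A : ℕ) :
    stdCoef c n ^ A * ((((n : ℝ) + 1) ^ A))⁻¹ = if n = 0 then 1 else c n ^ A := by
  by_cases h : n = 0
  · subst h
    simp [stdCoef]
  · have hn : ((n : ℝ) + 1) ≠ 0 := by positivity
    rw [if_neg h]
    unfold stdCoef
    rw [if_neg h, mul_pow, mul_comm (((n : ℝ) + 1) ^ A) (c n ^ A), mul_assoc,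
      mul_inv_cancel₀ (pow_ne_zero _ hn), mul_one]

/-- `Σ_{n=0}^{J} [n = 0 ? 1 : g n] = 1 + Σ_{n=1}^{J} g n`. -/
theorem sum_range_succ_ite_eq (J : ℕ) (g : ℕ → ℝ) :
    ∑ n ∈ Finset.range (J + 1), (if n = 0 then (1 : ℝ) else g n) = 1 + ∑ n ∈ Icc 1 J, g n := by
  rw [sum_range_succ_eq_add_sum_Icc, if_pos rfl]
  congr 1
  refine Finset.sum_congr rfl fun n hn => ?_
  have hn0 : n ≠ 0 := by have := (Finset.mem_Icc.1 hn).1; omega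
  rw [if_neg hn0]

/-! ### `Z` in closed form -/

/-- **The two-dimensional partition function in closed form** (Drouffe–Zuber §2.2; the genus-one character
formula): for every `L ≥ 1`, every spin cut-off `J` and every coefficient sequence `c`,
`Z_{(ℤ/L)²}({c_j}) = 1 + Σ_{n=1}^{J} c_n^{L²}`. -/
theorem torusZ_two (J : ℕ) (c : ℕ → ℝ) :
    torusZ 2 L J c = 1 + ∑ n ∈ Icc 1 J, c n ^ (L ^ 2) := by
  have hint : ∀ V : GaugeConfig 2 L SU2,
      (∏ p : Plaquette 2 L, plaqFn J c (plaquetteHolonomy V p.1 p.2.1.1 p.2.1.2)) =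
        ∏ x : Site 2 L, faceSum J (stdCoef c) (plaquetteHolonomy V x 0 1) := by
    intro V
    rw [prod_plaquette_two]
    refine Finset.prod_congr rfl fun x _ => ?_
    exact (plaqFn_hol_eq_fR J c V (x, ⟨((0 : Fin 2), (1 : Fin 2)), by decide⟩)).trans
      (fR_eq_faceSum J c V (x, ⟨((0 : Fin 2), (1 : Fin 2)), by decide⟩))
  unfold torusZ
  simp_rw [hint]
  rw [integral_prod_faceSum_two J (fun _ => stdCoef c)]
  simp_rw [Finset.prod_const, card_univ_site_two, stdCoef_pow_mul_inv]
  exact sum_range_succ_ite_eq J _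

/-! ### `Z⁻` in closed form, for every twist set -/

/-- The twisted plaquette function is the untwisted one at the sign-flipped coefficients
`c_j ↦ (−1)^{2j} c_j`. -/
theorem plaqFnTwist_eq_plaqFn_signed (J : ℕ) (c : ℕ → ℝ) (g : SU2) :
    plaqFnTwist J c g = plaqFn J (fun n => (-1 : ℝ) ^ n * c n) g := by
  unfold plaqFnTwist plaqFn
  congr 1
  refine Finset.sum_congr rfl fun n _ => ?_
  ring

/-- `stdCoef` of the sign-flipped coefficients is `(−1)^n · stdCoef`. -/
theorem stdCoef_signed (c : ℕ → ℝ) (n : ℕ) :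
    stdCoef (fun k => (-1 : ℝ) ^ k * c k) n = (-1 : ℝ) ^ n * stdCoef c n := by
  unfold stdCoef
  split_ifs with h
  · subst h; simp
  · ring

/-- The number of base sites of a plaquette set of `(ℤ/L)²` is its cardinality (plaquettes ARE sites). -/
theorem card_filter_site_mem_two (V : Finset (Plaquette 2 L)) :
    (Finset.univ.filter fun x : Site 2 L => (x, (⟨((0 : Fin 2), (1 : Fin 2)), by decide⟩ :
      {q : Fin 2 × Fin 2 // q.1 < q.2})) ∈ V).card = V.card := by
  classical
  have hV : V = (Finset.univ.filter fun x : Site 2 L =>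
      (x, (⟨((0 : Fin 2), (1 : Fin 2)), by decide⟩ : {q : Fin 2 × Fin 2 // q.1 < q.2})) ∈ V).image
      (fun x => (x, (⟨((0 : Fin 2), (1 : Fin 2)), by decide⟩ : {q : Fin 2 × Fin 2 // q.1 < q.2}))) := by
    ext p
    simp only [Finset.mem_image, Finset.mem_filter, Finset.mem_univ, true_and]
    constructor
    · intro hp
      refine ⟨p.1, ?_, (plaquette_two_eq p).symm⟩
      rwa [← plaquette_two_eq p]
    · rintro ⟨x, hx, rfl⟩
      exact hx
  conv_rhs => rw [hV]
  rw [Finset.card_image_of_injective _ (fun x y h => (Prod.ext_iff.1 h).1)]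

/-- **The twisted two-dimensional partition function in closed form**, for EVERY plaquette set `V`:
`Z⁻_V({c_j}) = 1 + Σ_{n=1}^{J} (−1)^{n·|V|} c_n^{L²}` — in two dimensions a twist is seen only through the
parity of `|V|`. -/
theorem torusZtw_two (J : ℕ) (c : ℕ → ℝ) (V : Finset (Plaquette 2 L)) :
    torusZtw 2 L J c V = 1 + ∑ n ∈ Icc 1 J, (-1 : ℝ) ^ (n * V.card) * c n ^ (L ^ 2) := by
  classical
  -- the plaquette-dependent coefficients: sign-flipped on `V`
  have hint : ∀ W : GaugeConfig 2 L SU2,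
      (∏ p : Plaquette 2 L, (if p ∈ V then plaqFnTwist J c (plaquetteHolonomy W p.1 p.2.1.1 p.2.1.2)
        else plaqFn J c (plaquetteHolonomy W p.1 p.2.1.1 p.2.1.2))) =
        ∏ x : Site 2 L, faceSum J
          ((fun (y : Site 2 L) (n : ℕ) =>
            (if (y, (⟨((0 : Fin 2), (1 : Fin 2)), by decide⟩ : {q : Fin 2 × Fin 2 // q.1 < q.2})) ∈ V
              then (-1 : ℝ) ^ n else 1) * stdCoef c n) x)
          (plaquetteHolonomy W x 0 1) := by
    intro W
    rw [prod_plaquette_two]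
    refine Finset.prod_congr rfl fun x _ => ?_
    by_cases hx : (x, (⟨((0 : Fin 2), (1 : Fin 2)), by decide⟩ : {q : Fin 2 × Fin 2 // q.1 < q.2})) ∈ V
    · rw [if_pos hx, plaqFnTwist_eq_plaqFn_signed]
      have h1 := (plaqFn_hol_eq_fR J (fun n => (-1 : ℝ) ^ n * c n) W
        (x, ⟨((0 : Fin 2), (1 : Fin 2)), by decide⟩)).trans
        (fR_eq_faceSum J (fun n => (-1 : ℝ) ^ n * c n) W (x, ⟨((0 : Fin 2), (1 : Fin 2)), by decide⟩))
      refine h1.trans ?_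
      unfold faceSum
      refine Finset.sum_congr rfl fun n _ => ?_
      simp only [if_pos hx, stdCoef_signed]
    · rw [if_neg hx]
      have h1 := (plaqFn_hol_eq_fR J c W (x, ⟨((0 : Fin 2), (1 : Fin 2)), by decide⟩)).trans
        (fR_eq_faceSum J c W (x, ⟨((0 : Fin 2), (1 : Fin 2)), by decide⟩))
      refine h1.trans ?_
      unfold faceSum
      refine Finset.sum_congr rfl fun n _ => ?_
      simp only [if_neg hx, one_mul]
  unfold torusZtw
  simp_rw [hint]
  rw [integral_prod_faceSum_two]
  have hprod : ∀ n : ℕ, ∏ x : Site 2 L,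
      (fun (y : Site 2 L) (n : ℕ) =>
        (if (y, (⟨((0 : Fin 2), (1 : Fin 2)), by decide⟩ : {q : Fin 2 × Fin 2 // q.1 < q.2})) ∈ V
          then (-1 : ℝ) ^ n else 1) * stdCoef c n) x n =
      (-1 : ℝ) ^ (n * V.card) * stdCoef c n ^ (L ^ 2) := by
    intro n
    simp only
    rw [Finset.prod_mul_distrib, Finset.prod_const, card_univ_site_two, Finset.prod_ite, Finset.prod_const,
      Finset.prod_const_one, mul_one, card_filter_site_mem_two V, ← pow_mul]
  simp_rw [hprod, mul_assoc, stdCoef_pow_mul_inv, mul_ite, mul_one]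
  rw [sum_range_succ_eq_add_sum_Icc]
  congr 1
  · simp
  · refine Finset.sum_congr rfl fun n hn => ?_
    have hn0 : n ≠ 0 := by have := (Finset.mem_Icc.1 hn).1; omega
    rw [if_neg hn0]

/-- In two dimensions Tomboulis's vortex "sheet" `𝒱₀₁` is the single plaquette at the origin. -/
theorem vortexSheet_two_eq (h : (0 : Fin 2) < 1) :
    vortexSheet L (0 : Fin 2) 1 h = {((0 : Site 2 L), ⟨((0 : Fin 2), (1 : Fin 2)), h⟩)} := by
  classical
  ext p
  simp only [vortexSheet, Finset.mem_filter, Finset.mem_univ, true_and, Finset.mem_singleton]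
  constructor
  · rintro ⟨h2, h0, h1⟩
    refine Prod.ext ?_ h2
    funext i
    fin_cases i
    · exact h0
    · exact h1
  · rintro rfl
    exact ⟨rfl, rfl, rfl⟩

/-- `|𝒱₀₁| = 1` in two dimensions. -/
theorem card_vortexSheet_two (h : (0 : Fin 2) < 1) : (vortexSheet L (0 : Fin 2) 1 h).card = 1 := by
  rw [vortexSheet_two_eq h, Finset.card_singleton]

/-- **Tomboulis's `Z⁻` on the 2-torus**: `Z⁻_{(ℤ/L)²}({c_j}) = 1 + Σ_{n=1}^{J} (−1)^n c_n^{L²}`. -/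
theorem torusZtw_two_vortexSheet (J : ℕ) (c : ℕ → ℝ) (h : (0 : Fin 2) < 1) :
    torusZtw 2 L J c (vortexSheet L (0 : Fin 2) 1 h) = 1 + ∑ n ∈ Icc 1 J, (-1 : ℝ) ^ n * c n ^ (L ^ 2) := by
  rw [torusZtw_two, card_vortexSheet_two h]
  simp_rw [mul_one]

end Summit.Ventures.YMGap.Census
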